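/-
Copyright (c) 2026 Gabriel Dahia. All rights reserved.
Released under Apache 2.0 license as described in the file LICENSE.
Authors: Gabriel Dahia

Ported into this library from `DensityHalesJewett/Insensitive.lean` of
github.com/gdahia/DensityHalesJewett @ 27e0e64 (Apache-2.0): the namespace `DensityHalesJewett`
becomes `Literature.Combinatorics.HalesJewett`, module names are flattened and docstrings
carry provenance tags; the mathematics is unchanged.
-/
import Literature.Combinatorics.HalesJewett.DKTSubspaces
import Literature.Combinatorics.HalesJewett.DKTCorrelation
import Mathlib.Logic.Equiv.Fin.Basic
import Mathlib.Algebra.BigOperators.Field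
import Mathlib.Algebra.Order.Archimedean.Real.Basic
import Mathlib.Tactic.FieldSimp
import Mathlib.Tactic.Linarith
import Mathlib.Order.Preorder.Finite
import HarnessLib

/-!
# Insensitive word families (Dodos–Kanellopoulos–Tyros, Def. 9) and the tiling predicates

First of the three files into which the upstream `Insensitive.lean` is split (CONVENTIONS §9):
* the `Fin (k+1)`-alphabet form of DKT Corollary 5 consumed by the tilings
  (`Subspace.exists_eventually_restrictAlphabet_subset`, derived from `mdhjStar_of_dhj` of the
  tree's `DKTSubspaces.lean` along `finSuccEquivLast : Fin (k+1) ≃ Option (Fin k)`, with the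
  least threshold `Subspace.restrictAlphabetBound`);
* DKT Def. 9: `InsensitiveEquiv i j`, `IsInsensitive i j D` for an arbitrary pair of letters of an
  arbitrary alphabet, its closure under reindexing, sections, complements and differences, and the
  bridge `insensitive_iff_isInsensitive` to the `Option` encoding of the tree's `DKTCorrelation.lean`;
* the bookkeeping notions of the tilings: `IsInsensitive.uncovered`, `IsInsensitive.intersection`,
  and the Lemma-12 predicate `IsInsensitive.TilingSufficient`. The tilings themselves (DKT Lemma 12,
  Cor. 13) are in the tree as `dkt_lemma12` / `dkt_cor13` of `DensityHalesJewettProofs.lean`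
  (`Option` encoding, to be moved across with the bridge below); the upstream port's own tiling
  files were not landed.

## Relation to `DKTSubspaces.lean` and `DKTCorrelation.lean` (same directory)

The §3 results of Dodos–Kanellopoulos–Tyros are taken from `DKTSubspaces.lean`: the induction
predicate is its `DHJ (Fin k)`, Corollary 5 is its `mdhjStar_of_dhj` (alphabet `Option α`), word
families are moved along coordinate equivalences with its `transport` / `mem_transport`.
`DKTCorrelation.lean` states Def. 9 in the `Option` encoding of the pair `(i, ∗)` as
`Insensitive i D`; `insensitive_iff_isInsensitive : Insensitive i D ↔ IsInsensitive (some i) none D`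
identifies the two. This file works in the encoding `[k+1] = Fin (k+1)` (new letter `Fin.last k`,
old letters `Fin.castSucc i`); statements of `DKTCorrelation.lean` / `DensityHalesJewettProofs.lean`
(`Option (Fin k)`, e.g. `dkt_cor11`, `dkt_lemma12`) are moved across with this bridge and the
alphabet equivalence `finSuccEquivLast`.

## Source of the formalization

This file is a port (namespace, imports and docstring tags only; proofs unchanged) of the file
`DensityHalesJewett/Insensitive.lean`
of the Apache-2.0 Lean 4 development github.com/gdahia/DensityHalesJewett @ 27e0e64 (G. Dahia 2026),
a formalization of Dodos–Kanellopoulos–Tyros, *A simple proof of the density Hales–Jewett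
theorem* (IMRN 2014).
Paper locators in the tags refer to that article (arXiv:1209.4986 numbering: Thm 1, Prop. 2–3,
Lemma 4, Cor. 5, Prop. 6, Lemmas 7–8, Def. 9, Lemma 10, Cor. 11, Lemma 12, Cor. 13).
Status (2026-08-15): of this port the tree holds `Word`, `Subspace`, `FiniteUnions`, `Canonization`,
`GrahamRothschild` and `Insensitive` (this directory). The density Hales–Jewett theorem itself was
completed in the tree by the parallel development `DKTSubspaces` / `DKTCorrelation` /
`DensityHalesJewettProofs` (`DensityHalesJewett_holds`; it builds on `Word.lean` and `Subspace.lean`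
of this port), and Szemerédi's theorem is discharged as
`Literature.Combinatorics.Additive.SzemerediTheorem_holds` in
`NumberTheory/Sieve/ParityWave0GreenTaoHolds.lean`; the remaining upstream files (`UniformFibers`,
the tilings of `Insensitive`, `DensityIncrement/…`, `Main`) were therefore not ported.

## References
* P. Dodos, V. Kanellopoulos, K. Tyros, *A simple proof of the density Hales–Jewett theorem*,
  IMRN 2014 (12), 3340–3352, arXiv:1209.4986. [cite: DodosKanellopoulosTyros2014]
* H. Furstenberg, Y. Katznelson, *A density version of the Hales–Jewett theorem*, J. Anal. Math. 57
  (1991), 64–119 — the theorem. [cite: FurstenbergKatznelson1991]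
* D. H. J. Polymath, *A new proof of the density Hales–Jewett theorem*, Ann. of Math. 175 (2012),
  1283–1327. [cite: Polymath2012DHJ]
-/
open Finset
open Combinatorics
open scoped BigOperators

namespace Literature.Combinatorics.HalesJewett

/-! ### DKT Corollary 5 for the alphabet `Fin (k+1)` (from `DKTSubspaces.mdhjStar_of_dhj`) -/

/-- **DKT Corollary 5, `Fin (k+1)`-alphabet form** (derived from `mdhjStar_of_dhj` of
`DKTSubspaces.lean` along `finSuccEquivLast : Fin (k+1) ≃ Option (Fin k)`): assuming `DHJ (Fin k)`,
`k ≥ 1`, `m ≥ 1`, `δ > 0`, for all large `n` every `A ⊆ [k+1]^n` of density `≥ δ` contains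
`V ↾ k` (`Subspace.restrictAlphabet V Fin.castSuccEmb`, see `Subspace.lean`) for some
`m`-dimensional subspace `V` of `[k+1]^n`. [cite: DodosKanellopoulosTyros2014, Corollary 5] -/
theorem Subspace.exists_eventually_restrictAlphabet_subset {k : ℕ} (hk : 0 < k) (h : DHJ (Fin k))
    (m : ℕ) (hm : 1 ≤ m) (δ : ℝ) (hδ : 0 < δ) :
    ∃ N : ℕ, ∀ n : ℕ, N ≤ n → ∀ A : Finset (Fin n → Fin (k + 1)), δ ≤ (A.dens : ℝ) →
      ∃ V : Combinatorics.Subspace (Fin m) (Fin (k + 1)) (Fin n),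
        restrictAlphabet V Fin.castSuccEmb ⊆ A := by
  classical
  obtain ⟨N, hN⟩ :=
    mdhjStar_of_dhj (α := Fin k) (by rw [Fintype.card_fin]; exact Nat.succ_le_of_lt hk) h hm hδ
  refine ⟨N, fun n hn A hA => ?_⟩
  let e : Fin (k + 1) ≃ Option (Fin k) := finSuccEquivLast
  let f : (Fin n → Fin (k + 1)) ↪ (Fin n → Option (Fin k)) :=
    ⟨fun w => e ∘ w, fun w w' hww' => by
      funext i
      exact e.injective (congrFun hww' i)⟩
  let A' : Finset (Fin n → Option (Fin k)) := A.map f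
  have hA' : δ ≤ rdens A' := by
    have hc : #A' = #A := card_map f
    rw [rdens_def, hc]
    have hA2 : δ ≤ (#A : ℝ) / Fintype.card (Fin n → Fin (k + 1)) := by
      rw [← Finset.nnratCast_dens]; exact hA
    convert hA2 using 2
    simp [Fintype.card_option]
  obtain ⟨V', hV'⟩ := hN (Fin n) (by simpa using hn) A' hA'
  refine ⟨V'.reindex (Equiv.refl _) e.symm (Equiv.refl _), ?_⟩
  intro w hw
  rw [restrictAlphabet, mem_image] at hw
  obtain ⟨z, -, rfl⟩ := hw
  have hmem := hV' z
  rw [mem_map] at hmem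
  obtain ⟨u, hu, hu'⟩ := hmem
  have hcomp : e ∘ (Fin.castSuccEmb ∘ z) = some ∘ z := by
    funext i
    simp [e, finSuccEquivLast_castSucc]
  have : (V'.reindex (Equiv.refl _) e.symm (Equiv.refl _)) (Fin.castSuccEmb ∘ z) = u := by
    funext i
    rw [Combinatorics.Subspace.reindex_apply]
    simp only [Equiv.refl_symm, Equiv.coe_refl, Function.comp_id, Equiv.symm_symm]
    have hu_i := congrFun hu' i
    simp only [f, Function.Embedding.coeFn_mk, Function.comp_apply] at hu_i
    rw [show (⇑e ∘ Fin.castSuccEmb ∘ z) = some ∘ z from hcomp]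
    show e.symm (V' (some ∘ z) i) = u i
    rw [← hu_i]
    simp
  rw [this]
  exact hu

/-- The threshold `MDHJ*(k, m, δ)` of the `Fin (k+1)`-alphabet form of DKT Cor. 5: the least `N` of
`Subspace.exists_eventually_restrictAlphabet_subset` (by `Nat.find`; junk value `0` when the
defining hypotheses `0 < k ∧ 1 ≤ m ∧ 0 < δ ∧ DHJ (Fin k)` fail, never used).
[cite: DodosKanellopoulosTyros2014, Corollary 5] -/
noncomputable def Subspace.restrictAlphabetBound (k m : ℕ) (δ : ℝ) : ℕ := by
  classical
  exact if h : 0 < k ∧ 1 ≤ m ∧ 0 < δ ∧ DHJ (Fin k) then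
    Nat.find (Subspace.exists_eventually_restrictAlphabet_subset h.1 h.2.2.2 m h.2.1 δ h.2.2.1)
  else 0

/-- Beyond `restrictAlphabetBound k m δ`, every `A ⊆ [k+1]^n` of density `≥ δ` contains `V ↾ k` for
some `m`-dimensional subspace `V` (given `DHJ (Fin k)`, `k ≥ 1`).
[cite: DodosKanellopoulosTyros2014, Corollary 5] -/
theorem Subspace.exists_restrictAlphabet_subset {k : ℕ} (hk : 0 < k) (hDHJ : DHJ (Fin k))
    (m : ℕ) (hm : 1 ≤ m) (δ : ℝ) (hδ : 0 < δ)
    (n : ℕ) (hn : Subspace.restrictAlphabetBound k m δ ≤ n)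
    (A : Finset (Fin n → Fin (k + 1))) (hA : δ ≤ (A.dens : ℝ)) :
    ∃ V : Combinatorics.Subspace (Fin m) (Fin (k + 1)) (Fin n),
      restrictAlphabet V Fin.castSuccEmb ⊆ A := by
  classical
  rw [Subspace.restrictAlphabetBound, dif_pos ⟨hk, hm, hδ, hDHJ⟩] at hn
  exact Nat.find_spec
    (Subspace.exists_eventually_restrictAlphabet_subset hk hDHJ m hm δ hδ) n hn A hA


/-- Two words are equivalent after freely interchanging the letters `i` and `j`.
[cite: DodosKanellopoulosTyros2014, Def. 9 ((i,j)-equivalent words)] -/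
def InsensitiveEquiv {α ι : Type*} (i j : α) (x y : ι → α) : Prop :=
  ∀ a, a ≠ i → a ≠ j → ∀ c, (x c = a ↔ y c = a)

/-- Membership in an `(i,j)`-insensitive family is constant on insensitive-equivalence classes
(DKT Def. 9, as printed, for an arbitrary pair of letters `i, j`; the paper assumes `i ≠ j`, which
is not required here: for `i = j` the relation `InsensitiveEquiv i i x y` is `x = y` and every
family is insensitive — a harmless junk case, every use below has `i = castSucc _ ≠ last k = j`).
The tree's `DKTCorrelation.lean` has the same notion in the `Option` encoding of the pair
`(i, ∗)`, `Insensitive i D`; the bridge is `insensitive_iff_isInsensitive` below.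
[cite: DodosKanellopoulosTyros2014, Def. 9 ((i,j)-insensitive sets)] -/
def IsInsensitive {α ι : Type*} (i j : α) (D : Finset (ι → α)) : Prop :=
  ∀ ⦃x y⦄, InsensitiveEquiv i j x y → (x ∈ D ↔ y ∈ D)

/-- The two-letter equivalence for the pair `(some i, none)` of the `Option` encoding is equality of
the words read with `∗ ↦ i` (`wordLine`, `DKTCorrelation.lean`). [folklore] -/
theorem insensitiveEquiv_some_none_iff {α ι : Type*} (i : α) (x y : ι → Option α) :
    InsensitiveEquiv (some i) none x y ↔ wordLine x i = wordLine y i := by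
  constructor
  · intro h
    funext c
    simp only [wordLine]
    cases hx : x c with
    | none =>
      cases hy : y c with
      | none => rfl
      | some b =>
        by_cases hb : b = i
        · subst hb; rfl
        · exact absurd ((h (some b) (by simpa using hb) (by simp) c).2 hy) (by simp [hx])
    | some a =>
      by_cases ha : a = i
      · subst ha
        cases hy : y c with
        | none => rfl
        | some b =>
          by_cases hb : b = a
          · subst hb; rfl
          · exact absurd ((h (some b) (by simpa using hb) (by simp) c).2 hy) (by simp [hx, Ne.symm hb])
      · have := (h (some a) (by simpa using ha) (by simp) c).1 hx
        simp [this]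
  · intro h a hai haj c
    obtain ⟨b, rfl⟩ := Option.ne_none_iff_exists'.1 haj
    have hb : b ≠ i := fun hbi => hai (by rw [hbi])
    have hc := congrFun h c
    simp only [wordLine] at hc
    constructor
    · intro hx
      rw [hx] at hc
      cases hy : y c with
      | none => rw [hy] at hc; simp only [Option.getD_some, Option.getD_none] at hc; exact absurd hc hb
      | some b' => rw [hy] at hc; simp only [Option.getD_some] at hc; rw [hc]
    · intro hy
      rw [hy] at hc
      cases hx : x c with
      | none => rw [hx] at hc; simp only [Option.getD_some, Option.getD_none] at hc; exact absurd hc.symm hb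
      | some a' => rw [hx] at hc; simp only [Option.getD_some] at hc; rw [hc]

/-- **Bridge between the two encodings of DKT Def. 9 in this directory**: `DKTCorrelation.lean`'s
`Insensitive i D` (alphabet `Option α`, the pair `(i, ∗)`) is this file's
`IsInsensitive (some i) none D`. [cite: DodosKanellopoulosTyros2014, Definition 9] -/
theorem insensitive_iff_isInsensitive {α ι : Type*} (i : α) (D : Finset (ι → Option α)) :
    Insensitive i D ↔ IsInsensitive (some i) none D := by
  constructor
  · intro h x y hxy
    exact h x y ((insensitiveEquiv_some_none_iff i x y).1 hxy)
  · intro h x y hxy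
    exact h ((insensitiveEquiv_some_none_iff i x y).2 hxy)


/-- `Finset.dens` is invariant under `transport` (`DKTSubspaces.lean`; the `ℚ≥0`-valued form of its
`rdens_transport`). [folklore] -/
@[simp]
lemma dens_transport {α ι ι' : Type*} [Fintype (ι → α)] [Fintype (ι' → α)]
    (e : ι ≃ ι') (D : Finset (ι → α)) : (transport e D).dens = D.dens := by
  rw [Finset.dens, Finset.dens, card_transport, Fintype.card_congr (e.arrowCongr (Equiv.refl α))]

/-- Fix the coordinates outside a designated block, keeping a subspace on the block. [folklore] -/
def transportSubspace {α η ι ω ν : Type*} (e : ι ≃ ω ⊕ ν) (z : ω → α)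
    (V : Combinatorics.Subspace η α ν) : Combinatorics.Subspace η α ι where
  idxFun c := Sum.elim (fun a ↦ Sum.inl (z a)) V.idxFun (e c)
  proper x := by
    obtain ⟨c, hc⟩ := V.proper x
    exact ⟨e.symm (Sum.inr c), by simp only [Equiv.apply_symm_apply, Sum.elim_inr, hc]⟩

/-- Evaluating the transported subspace gives the fixed block `z` next to the evaluation of `V`,
reassembled along `e`. [folklore] -/
@[simp]
lemma transportSubspace_apply {α η ι ω ν : Type*} (e : ι ≃ ω ⊕ ν) (z : ω → α)
    (V : Combinatorics.Subspace η α ν) (x : η → α) :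
    transportSubspace e z V x = Sum.elim z (V x) ∘ e := by
  funext c
  simp only [Combinatorics.Subspace.coe_apply, transportSubspace, Function.comp_apply]
  cases e c <;> simp only [Sum.elim_inl, Sum.elim_inr, id_eq, Combinatorics.Subspace.coe_apply]

namespace IsInsensitive

/-- Reindexing coordinates preserves insensitivity.
[cite: DodosKanellopoulosTyros2014, §4.1 (after Def. 9: closure under set operations)] -/
lemma reindex {α ι ι' : Type*}
    {i j : α} {D : Finset (ι → α)} (e : ι ≃ ι') (hD : IsInsensitive i j D) :
    IsInsensitive i j (Literature.Combinatorics.HalesJewett.transport e D) := by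
  intro x y hxy
  simp only [mem_transport]
  apply hD
  intro a hai haj c
  exact hxy a hai haj (e c)

/-- Fixing a prefix of coordinates preserves insensitivity of the remaining section.
[cite: DodosKanellopoulosTyros2014, §4.1 (after Def. 9: closure under set operations)] -/
lemma fiberSection {α ι κ : Type*} [Fintype (κ → α)] [DecidableEq (ι ⊕ κ → α)]
    {i j : α} {D : Finset (ι ⊕ κ → α)} (hD : IsInsensitive i j D) (v : ι → α) :
    IsInsensitive i j (Literature.Combinatorics.HalesJewett.fiber D v) := by
  intro x y hxy
  simp only [mem_fiber]
  apply hD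
  intro a hai haj c
  cases c with
  | inl c => simp only [Sum.elim_inl]
  | inr c => exact hxy a hai haj c

/-- Complements preserve insensitivity.
[cite: DodosKanellopoulosTyros2014, §4.1 (after Def. 9: closure under set operations)] -/
lemma compl {α ι : Type*} [Fintype (ι → α)] [DecidableEq (ι → α)]
    {i j : α} {D : Finset (ι → α)} (hD : IsInsensitive i j D) :
    IsInsensitive i j Dᶜ := by
  intro x y hxy
  simp only [mem_compl, hD hxy]

/-- The part of `D` left uncovered by a set of subspaces. [folklore] -/
noncomputable def uncovered {η α ι : Type*} [Fintype (η → α)]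
    [DecidableEq (ι → α)] (D : Finset (ι → α))
    (𝒱 : Set (Combinatorics.Subspace η α ι)) : Finset (ι → α) := by
  classical
  exact D.filter fun w ↦ ∀ V ∈ 𝒱, w ∉ Subspace.range V

/-- The intersection of a finite indexed family of finite sets. [folklore] -/
noncomputable def intersection {r : ℕ} {X : Type*} [Fintype X]
    (D : Fin r → Finset X) : Finset X := by
  classical
  exact Finset.univ.inf D

/-- Membership in the indexed intersection is membership in every member. [folklore] -/
@[simp]
lemma mem_intersection {r : ℕ} {X : Type*} [Fintype X]
    {D : Fin r → Finset X} {x : X} :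
    x ∈ intersection D ↔ ∀ i, x ∈ D i := by
  simp [intersection, ← Finset.singleton_subset_iff, Finset.le_inf_iff]

/-- An ambient dimension is sufficient for tiling every dense one-pair insensitive family.
[cite: DodosKanellopoulosTyros2014, Lemma 12] -/
def TilingSufficient (k m : ℕ) (β : ℝ) (n : ℕ) : Prop :=
  ∀ i : Fin k, ∀ D : Finset (Fin n → Fin (k + 1)),
    IsInsensitive i.castSucc (Fin.last k) D →
    2 * β ≤ (D.dens : ℝ) →
    ∃ 𝒱 : Set (Combinatorics.Subspace (Fin m) (Fin (k + 1)) (Fin n)),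
      𝒱.Finite ∧
      (∀ V ∈ 𝒱, Subspace.IsContained V D) ∧
      (𝒱.PairwiseDisjoint fun V ↦ (Subspace.range V : Set (Fin n → Fin (k + 1)))) ∧
      ((uncovered D 𝒱).dens : ℝ) < 2 * β

/-- Differences preserve insensitivity.
[cite: DodosKanellopoulosTyros2014, §4.1 (after Def. 9: closure under set operations)] -/
lemma sdiff {α ι : Type*} [DecidableEq (ι → α)]
    {i j : α} {D E : Finset (ι → α)} (hD : IsInsensitive i j D)
    (hE : IsInsensitive i j E) : IsInsensitive i j (D \ E) := by
  intro x y hxy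
  simp [hD hxy, hE hxy]

/-- Insensitive-equivalent prefixes have the same section.
[cite: DodosKanellopoulosTyros2014, §4.1 (after Def. 9: closure under set operations)] -/
lemma fiber_congr {α ι κ : Type*} [Fintype (κ → α)] [DecidableEq (ι ⊕ κ → α)]
    {i j : α} {D : Finset (ι ⊕ κ → α)} (hD : IsInsensitive i j D) {v w : ι → α}
    (hvw : InsensitiveEquiv i j v w) :
    Literature.Combinatorics.HalesJewett.fiber D v =
      Literature.Combinatorics.HalesJewett.fiber D w := by
  ext y
  simp only [mem_fiber]
  apply hD
  intro a hai haj c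
  cases c with
  | inl c => exact hvw a hai haj c
  | inr c => simp only [Sum.elim_inr]

end IsInsensitive

end Literature.Combinatorics.HalesJewett
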